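import Literature.NumberTheory.Automorphic.AdelicPoissonSummation
import Literature.NumberTheory.Automorphic.IdeleNormOneSplitting
import Literature.NumberTheory.Automorphic.IwasawaHaarGL2
import HarnessLib

/-!
# Finitely many rational Borel elements `μ n(t)` meet `K · (A_G C) · K⁻¹` modulo `N`
(Gelbart, *Automorphic forms on adele groups* (1975), §9.B, proof of Lemma 9.13 and (9.45): in
`Σ_{μ ∈ A_ℚ} Σ_{ν ∈ N_ℚ} f(x⁻¹ μ ν x)` "only finitely many `μ` contribute, uniformly for `x` in the
Siegel domain", since `f` has compact support modulo `Z_∞⁺`)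

Topic `NumberTheory/Automorphic`; theorems only. For a compact `C ⊆ GL₂(𝔸_K)`:

* `AdeleRing.finite_setOf_algebraMap_mem` — `{ξ ∈ K : ι(ξ) ∈ E}` is finite for compact `E ⊆ 𝔸_K`
  (`K` is discrete and closed in `𝔸_K`); `finite_setOf_coe_principalIdele_mem` (units);
  `finite_setOf_principalIdele_mem_posRealIdeles_mul` — `{ξ ∈ Kˣ : ι(ξ) ∈ ρ(ℝ_{>0}) · D}` is finite
  for compact `D ⊆ 𝔸_Kˣ` (norm-one retraction).
* `GL2.traceSqDivDet…` — the invariant `I(g) = tr(g)² / det g` of `GL₂`: invariant under conjugation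
  and under positive real scalars, continuous, and `I(d(μ₁, μ₂) n(t)) = ι((μ₁ + μ₂)² / (μ₁ μ₂))`.
* `GL2.finite_setOf_diag_conj_mem` — **main**: the set of `(μ₁, μ₂) ∈ Kˣ × Kˣ` for which some
  `k d(ι μ₁, ι μ₂) n(t) k⁻¹` (`k ∈ K`, `t ∈ 𝔸_K`) lies in `A_G · C` is finite (the invariant pins
  `(μ₁ + μ₂)²/(μ₁ μ₂)` to a finite set, the determinant pins `μ₁ μ₂` modulo `ρ(ℝ_{>0})` to a finite
  set, and each fibre has at most four elements).

Part of the inline (D-0026) decomposition of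
`Literature.NumberTheory.Automorphic.jacquetLanglands_transfer_exists` (the `J`-part of the
parabolic term of the `GL₂` trace formula: the Borel sum `F_B(y) = Σ_{β ∈ B(K) ∖ Z} Ψ_A(y β y⁻¹)`
at `y = k d(a) n(x)` only involves the diagonal parts `μ` of this finite set).

## References

* S. Gelbart, *Automorphic forms on adele groups*, Ann. of Math. Studies 83 (1975), §9.B,
  Lemma 9.13, (9.45) [Gelbart1975].
* J. W. S. Cassels, A. Fröhlich (eds.), *Algebraic Number Theory* (1967), Ch. II §14 (discreteness
  of `K` in `𝔸_K`) [CasselsFrohlichANT1967].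
-/

noncomputable section

open NumberField IsDedekindDomain Matrix Set
open scoped MatrixGroups NNReal Pointwise

namespace Literature.NumberTheory.Automorphic

open Literature.NumberTheory.GaloisRepresentations (ideleGroup)

/-! ### Rational points in compact sets -/

section Rational

variable (K : Type) [Field K] [NumberField K]

local notation "𝔸K" => AdeleRing (𝓞 K) K
local notation "𝕀K" => (AdeleRing (𝓞 K) K)ˣ

/-- **`{ξ ∈ K : ι(ξ) ∈ E}` is finite for compact `E ⊆ 𝔸_K`** (`K` is a discrete closed subgroup of
`𝔸_K`). [cite: CasselsFrohlichANT1967, Ch. II §14 Theorem] -/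
theorem AdeleRing.finite_setOf_algebraMap_mem {E : Set 𝔸K} (hE : IsCompact E) :
    Set.Finite {ξ : K | algebraMap K 𝔸K ξ ∈ E} := by
  haveI : T2Space 𝔸K := t2Space_adeleRing K
  haveI := AdeleRing.discreteTopology_principalSubgroup K
  have hc : IsCompact (Subtype.val ⁻¹' E : Set ↥(AdeleRing.principalSubgroup (𝓞 K) K)) :=
    (isClosed_principalSubgroup K).isClosedEmbedding_subtypeVal.isCompact_preimage hE
  have hfin : (Subtype.val ⁻¹' E : Set ↥(AdeleRing.principalSubgroup (𝓞 K) K)).Finite :=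
    hc.finite_of_discrete
  have heq : {ξ : K | algebraMap K 𝔸K ξ ∈ E} = principalSubgroupEquiv K ⁻¹' (Subtype.val ⁻¹' E) := by
    ext ξ
    simp only [Set.mem_setOf_eq, Set.mem_preimage, coe_principalSubgroupEquiv]
  rw [heq]
  exact hfin.preimage (principalSubgroupEquiv K).injective.injOn

/-- `{ξ ∈ Kˣ : ι(ξ) ∈ E}` is finite for compact `E ⊆ 𝔸_K`. [folklore] -/
theorem finite_setOf_coe_principalIdele_mem {E : Set 𝔸K} (hE : IsCompact E) :
    Set.Finite {ξ : Kˣ | ((principalIdele K ξ : 𝕀K) : 𝔸K) ∈ E} := by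
  have h := AdeleRing.finite_setOf_algebraMap_mem K hE
  have heq : {ξ : Kˣ | ((principalIdele K ξ : 𝕀K) : 𝔸K) ∈ E} =
      Units.val ⁻¹' {ξ : K | algebraMap K 𝔸K ξ ∈ E} := by
    ext ξ; rfl
  rw [heq]
  exact h.preimage Units.val_injective.injOn

/-- **`{ξ ∈ Kˣ : ι(ξ) ∈ ρ(ℝ_{>0}) · D}` is finite for compact `D ⊆ 𝔸_Kˣ`**: `ι(ξ) = m d` forces
`ι(ξ) = r(ι(ξ)) = r(d)` to lie in the compact `r(D)` (`r` the norm-one retraction). [folklore] -/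
theorem finite_setOf_principalIdele_mem_posRealIdeles_mul {D : Set 𝕀K} (hD : IsCompact D) :
    Set.Finite {ξ : Kˣ | principalIdele K ξ ∈ (posRealIdeles K : Set 𝕀K) * D} := by
  have hE : IsCompact (Units.val '' (normOneRetraction K '' D) : Set 𝔸K) :=
    (hD.image (continuous_normOneRetraction K)).image Units.continuous_val
  refine (finite_setOf_coe_principalIdele_mem K hE).subset ?_
  rintro ξ ⟨m, hm, d, hd, hmd⟩
  refine ⟨principalIdele K ξ, ⟨d, hd, ?_⟩, rfl⟩
  rw [← normOneRetraction_eq_self K (ideleNorm_principal ⟨ξ, rfl⟩), ← hmd, map_mul,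
    normOneRetraction_eq_one_of_mem K hm, one_mul]

omit [NumberField K] in
/-- `{x : x² = a}` has at most two elements in a field. [folklore] -/
theorem finite_setOf_sq_eq (a : K) : Set.Finite {x : K | x ^ 2 = a} := by
  by_cases h : ∃ r : K, r ^ 2 = a
  · obtain ⟨r, rfl⟩ := h
    refine (Set.toFinite ({r, -r} : Set K)).subset ?_
    intro x hx
    rcases sq_eq_sq_iff_eq_or_eq_neg.1 hx with h1 | h1
    · exact Or.inl h1
    · exact Or.inr h1
  · have : {x : K | x ^ 2 = a} = ∅ := Set.eq_empty_of_forall_notMem fun x hx => h ⟨x, hx⟩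
    rw [this]; exact Set.finite_empty

/-- **Fibres of `(μ₁ + μ₂)²/(μ₁μ₂)` and `μ₁μ₂`**: for `f ∈ K`, `p ∈ Kˣ` the set of
`(μ₁, μ₂) ∈ Kˣ × Kˣ` with `(μ₁ + μ₂)² (μ₁ μ₂)⁻¹ = f` and `μ₁ μ₂ = p` is finite (`μ₁` is a root of
`4 X² - 4 σ X + 4 p` with `σ² = f p`, and `μ₂ = p μ₁⁻¹`). [folklore] -/
theorem finite_setOf_units_traceSq_det_eq (f : K) (p : Kˣ) :
    Set.Finite {μ : Kˣ × Kˣ | ((μ.1 : K) + μ.2) ^ 2 * ((μ.1 * μ.2)⁻¹ : Kˣ) = f ∧ μ.1 * μ.2 = p} := by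
  -- the finitely many possible values of `μ₁`
  set T : Set K := {σ : K | σ ^ 2 = f * p} with hT
  have hTf : T.Finite := finite_setOf_sq_eq K _
  set S : Set K := ⋃ σ ∈ T, {x : K | (2 * x - σ) ^ 2 = σ ^ 2 - 4 * p} with hS
  have hSf : S.Finite := by
    refine hTf.biUnion fun σ _ => ?_
    have h2 : (2 : K) ≠ 0 := two_ne_zero
    have hinj : Set.InjOn (fun x : K => 2 * x - σ) Set.univ := by
      intro x _ y _ hxy
      have : 2 * x = 2 * y := by linear_combination hxy
      exact mul_left_cancel₀ h2 this
    have : {x : K | (2 * x - σ) ^ 2 = σ ^ 2 - 4 * p} =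
        (fun x : K => 2 * x - σ) ⁻¹' {y : K | y ^ 2 = σ ^ 2 - 4 * p} := rfl
    rw [this]
    exact (finite_setOf_sq_eq K _).preimage (hinj.mono (Set.subset_univ _))
  -- `μ ↦ μ₁` is injective on the fibre and lands in `S`
  refine Set.Finite.of_finite_image (f := fun μ : Kˣ × Kˣ => (μ.1 : K)) (hSf.subset ?_) ?_
  · rintro _ ⟨μ, ⟨hf, hp⟩, rfl⟩
    have hp' : (μ.1 : K) * μ.2 = p := by rw [← Units.val_mul, hp]
    have hf' : ((μ.1 : K) + μ.2) ^ 2 = f * p := by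
      rw [← hf, hp, mul_assoc, Units.inv_mul, mul_one]
    refine Set.mem_iUnion₂.2 ⟨(μ.1 : K) + μ.2, hf', ?_⟩
    change (2 * (μ.1 : K) - ((μ.1 : K) + μ.2)) ^ 2 = ((μ.1 : K) + μ.2) ^ 2 - 4 * p
    rw [← hp']
    ring
  · rintro μ ⟨-, hμ⟩ μ' ⟨-, hμ'⟩ h1
    have h1' : μ.1 = μ'.1 := Units.ext h1
    have h2' : μ.2 = μ'.2 := by
      have e1 : μ.2 = μ.1⁻¹ * p := by rw [← hμ, inv_mul_cancel_left]
      have e2 : μ'.2 = μ'.1⁻¹ * p := by rw [← hμ', inv_mul_cancel_left]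
      rw [e1, e2, h1']
    exact Prod.ext h1' h2'

end Rational

/-! ### The invariant `tr(g)² / det g` of `GL₂` -/

section Invariant

variable {R : Type*} [CommRing R]

/-- `tr(k g k⁻¹)² / det(k g k⁻¹) = tr(g)² / det g`. [folklore] -/
theorem GL2.traceSq_mul_detInv_conj (k g : GL (Fin 2) R) :
    Matrix.trace ((k * g * k⁻¹ : GL (Fin 2) R) : Matrix (Fin 2) (Fin 2) R) ^ 2 *
        (((Matrix.GeneralLinearGroup.det (k * g * k⁻¹))⁻¹ : Rˣ) : R) =
      Matrix.trace (g : Matrix (Fin 2) (Fin 2) R) ^ 2 *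
        (((Matrix.GeneralLinearGroup.det g)⁻¹ : Rˣ) : R) := by
  rw [Units.val_mul, Units.val_mul, Matrix.trace_units_conj, map_mul, map_mul, map_inv,
    mul_inv_cancel_comm]

/-- `tr(z c)² / det(z c) = tr(c)² / det c` for a scalar matrix `z = s · 1`. [folklore] -/
theorem GL2.traceSq_mul_detInv_scalar_mul {s : Rˣ} {z : GL (Fin 2) R}
    (hz : (z : Matrix (Fin 2) (Fin 2) R) = (s : R) • (1 : Matrix (Fin 2) (Fin 2) R)) (c : GL (Fin 2) R) :
    Matrix.trace ((z * c : GL (Fin 2) R) : Matrix (Fin 2) (Fin 2) R) ^ 2 *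
        (((Matrix.GeneralLinearGroup.det (z * c))⁻¹ : Rˣ) : R) =
      Matrix.trace (c : Matrix (Fin 2) (Fin 2) R) ^ 2 *
        (((Matrix.GeneralLinearGroup.det c)⁻¹ : Rˣ) : R) := by
  have hdz : Matrix.GeneralLinearGroup.det z = s ^ 2 := by
    refine Units.ext ?_
    rw [Matrix.GeneralLinearGroup.val_det_apply, hz, Matrix.det_smul, Matrix.det_one, mul_one,
      Fintype.card_fin, Units.val_pow_eq_pow_val]
  rw [Units.val_mul, hz, smul_mul_assoc, one_mul, Matrix.trace_smul, map_mul, hdz, mul_inv,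
    Units.val_mul, smul_eq_mul, ← inv_pow, Units.val_pow_eq_pow_val]
  have : ((s : R) * Matrix.trace (c : Matrix (Fin 2) (Fin 2) R)) ^ 2 *
      ((((s⁻¹ : Rˣ) : R)) ^ 2 * (((Matrix.GeneralLinearGroup.det c)⁻¹ : Rˣ) : R)) =
      ((s : R) * ((s⁻¹ : Rˣ) : R)) ^ 2 * (Matrix.trace (c : Matrix (Fin 2) (Fin 2) R) ^ 2 *
        (((Matrix.GeneralLinearGroup.det c)⁻¹ : Rˣ) : R)) := by ring
  rw [this, Units.mul_inv, one_pow, one_mul]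

/-- `tr² / det` of `d(p₁, p₂) n(t)` is `(p₁ + p₂)² (p₁ p₂)⁻¹`. [folklore] -/
theorem GL2.traceSq_mul_detInv_diagGL2_mul_unipotentGL2 (p₁ p₂ : Rˣ) (t : R) :
    Matrix.trace ((diagGL2 p₁ p₂ * ((unipotentGL2 t : ↥(upperUnitriangular (Fin 2) R)) :
        GL (Fin 2) R) : GL (Fin 2) R) : Matrix (Fin 2) (Fin 2) R) ^ 2 *
        (((Matrix.GeneralLinearGroup.det (diagGL2 p₁ p₂ *
          ((unipotentGL2 t : ↥(upperUnitriangular (Fin 2) R)) : GL (Fin 2) R)))⁻¹ : Rˣ) : R) =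
      ((p₁ : R) + p₂) ^ 2 * (((p₁ * p₂)⁻¹ : Rˣ) : R) := by
  have hmat : ((diagGL2 p₁ p₂ * ((unipotentGL2 t : ↥(upperUnitriangular (Fin 2) R)) :
      GL (Fin 2) R) : GL (Fin 2) R) : Matrix (Fin 2) (Fin 2) R) = !![(p₁ : R), (p₁ : R) * t; 0, (p₂ : R)] := by
    rw [Units.val_mul, coe_diagGL2, coe_unipotentGL2]
    ext i j
    fin_cases i <;> fin_cases j <;> simp [Matrix.mul_apply, Fin.sum_univ_two]
  have hdet : Matrix.GeneralLinearGroup.det (diagGL2 p₁ p₂ *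
      ((unipotentGL2 t : ↥(upperUnitriangular (Fin 2) R)) : GL (Fin 2) R)) = p₁ * p₂ := by
    refine Units.ext ?_
    rw [Matrix.GeneralLinearGroup.val_det_apply, hmat, Matrix.det_fin_two_of, Units.val_mul]
    ring
  rw [hdet, hmat, Matrix.trace_fin_two_of]

variable [TopologicalSpace R] [IsTopologicalRing R]

/-- `g ↦ tr(g)² / det g` is continuous on `GL₂(R)`. [folklore] -/
theorem GL2.continuous_traceSq_mul_detInv :
    Continuous fun g : GL (Fin 2) R => Matrix.trace (g : Matrix (Fin 2) (Fin 2) R) ^ 2 *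
      (((Matrix.GeneralLinearGroup.det g)⁻¹ : Rˣ) : R) := by
  refine ((Units.continuous_val.matrix_trace).pow 2).mul ?_
  exact Units.continuous_val.comp (continuous_inv.comp Matrix.GeneralLinearGroup.continuous_det)

end Invariant

/-! ### The finiteness theorem -/

section Main

variable (K : Type) [Field K] [NumberField K]

local notation "𝔸K" => AdeleRing (𝓞 K) K
local notation "𝕀K" => (AdeleRing (𝓞 K) K)ˣ

/-- The matrix of a positive real scalar `z(ρ)` is `ρ̃ • 1`. [folklore] -/
theorem coe_posRealScalar_two (t : ℝ≥0ˣ) :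
    ((posRealScalar 2 K t : GL (Fin 2) 𝔸K) : Matrix (Fin 2) (Fin 2) 𝔸K) =
      (((posRealIdele K t : 𝕀K) : 𝔸K)) • (1 : Matrix (Fin 2) (Fin 2) 𝔸K) := by
  rw [posRealScalar_eq_posRealDiagonal_const, coe_posRealDiagonal, Matrix.smul_one_eq_diagonal]

/-- **Finitely many diagonal parts.** For a compact `C ⊆ GL₂(𝔸_K)`, the set of
`(μ₁, μ₂) ∈ Kˣ × Kˣ` such that `k · d(ι μ₁, ι μ₂) n(t) · k⁻¹ = z · c` for some `k ∈ K`,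
`t ∈ 𝔸_K`, `z ∈ A_G` and `c ∈ C` is finite (Gelbart (1975), proof of Lemma 9.13: only finitely
many `μ ∈ A_ℚ` contribute to `Σ_μ Σ_ν f(x⁻¹ μ ν x)`, uniformly in `x`). [cite: Gelbart1975, Lemma 9.13] -/
theorem GL2.finite_setOf_diag_conj_mem {C : Set (GL (Fin 2) 𝔸K)} (hC : IsCompact C) :
    Set.Finite {μ : Kˣ × Kˣ | ∃ k ∈ standardMaximalCompactGL 2 K, ∃ t : 𝔸K,
      ∃ z ∈ (posRealScalar 2 K).range, ∃ c ∈ C,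
        k * (diagGL2 (principalIdele K μ.1) (principalIdele K μ.2) *
          ((unipotentGL2 t : ↥(adelicUnipotent 2 K)) : GL (Fin 2) 𝔸K)) * k⁻¹ = z * c} := by
  -- the invariant on `C` and the finitely many values of `(μ₁ + μ₂)² / (μ₁ μ₂)`
  set I : GL (Fin 2) 𝔸K → 𝔸K := fun g => Matrix.trace (g : Matrix (Fin 2) (Fin 2) 𝔸K) ^ 2 *
    (((Matrix.GeneralLinearGroup.det g)⁻¹ : 𝕀K) : 𝔸K) with hI
  have hIc : Continuous I := GL2.continuous_traceSq_mul_detInv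
  have hF : Set.Finite {f : K | algebraMap K 𝔸K f ∈ I '' C} :=
    AdeleRing.finite_setOf_algebraMap_mem K (hC.image hIc)
  -- the determinant on `C` and the finitely many values of `μ₁ μ₂`
  have hP : Set.Finite {ξ : Kˣ | principalIdele K ξ ∈ (posRealIdeles K : Set 𝕀K) *
      (Matrix.GeneralLinearGroup.det '' C)} :=
    finite_setOf_principalIdele_mem_posRealIdeles_mul K (hC.image Matrix.GeneralLinearGroup.continuous_det)
  -- cover by the finite fibres
  refine ((hF.prod hP).biUnion fun q _ => finite_setOf_units_traceSq_det_eq K q.1 q.2).subset ?_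
  rintro μ ⟨k, hk, t, z, ⟨τ, rfl⟩, c, hc, heq⟩
  set g : GL (Fin 2) 𝔸K := diagGL2 (principalIdele K μ.1) (principalIdele K μ.2) *
    ((unipotentGL2 t : ↥(adelicUnipotent 2 K)) : GL (Fin 2) 𝔸K) with hg
  -- the invariant of `g`
  have hIg : I g = algebraMap K 𝔸K (((μ.1 : K) + μ.2) ^ 2 * ((μ.1 * μ.2)⁻¹ : Kˣ)) := by
    simp only [hI, hg]
    rw [GL2.traceSq_mul_detInv_diagGL2_mul_unipotentGL2, map_mul, map_pow, map_add, ← map_mul,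
      ← map_inv]
    rfl
  have hIc' : I c = I g := by
    have h1 : I (posRealScalar 2 K τ * c) = I c :=
      GL2.traceSq_mul_detInv_scalar_mul (coe_posRealScalar_two K τ) c
    rw [← h1, ← heq]
    exact GL2.traceSq_mul_detInv_conj k g
  -- the determinant of `g`
  have hdet : Matrix.GeneralLinearGroup.det g = principalIdele K (μ.1 * μ.2) := by
    rw [hg, map_mul]
    refine Units.ext ?_
    have hmat := GL2.traceSq_mul_detInv_diagGL2_mul_unipotentGL2 (principalIdele K μ.1)
      (principalIdele K μ.2) t
    -- compute directly
    rw [map_mul, Units.val_mul, Units.val_mul, Matrix.GeneralLinearGroup.val_det_apply,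
      Matrix.GeneralLinearGroup.val_det_apply, coe_diagGL2, coe_unipotentGL2,
      Matrix.det_fin_two_of, Matrix.det_fin_two_of]
    simp
  have hdet' : principalIdele K (μ.1 * μ.2) ∈ (posRealIdeles K : Set 𝕀K) *
      (Matrix.GeneralLinearGroup.det '' C) := by
    have h1 : Matrix.GeneralLinearGroup.det (k * g * k⁻¹) = Matrix.GeneralLinearGroup.det g := by
      rw [map_mul, map_mul, map_inv, mul_inv_cancel_comm]
    have h2 : Matrix.GeneralLinearGroup.det (posRealScalar 2 K τ * c) =
        Matrix.GeneralLinearGroup.det (posRealScalar 2 K τ) * Matrix.GeneralLinearGroup.det c :=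
      map_mul _ _ _
    have h3 : Matrix.GeneralLinearGroup.det (posRealScalar 2 K τ) = posRealIdele K (τ ^ 2) := by
      refine Units.ext ?_
      rw [Matrix.GeneralLinearGroup.val_det_apply, coe_posRealScalar_two, Matrix.det_smul,
        Matrix.det_one, mul_one, Fintype.card_fin, map_pow, Units.val_pow_eq_pow_val]
    rw [← hdet, ← h1, heq, h2, h3]
    exact Set.mul_mem_mul ⟨τ ^ 2, rfl⟩ ⟨c, hc, rfl⟩
  refine Set.mem_iUnion₂.2 ⟨(((μ.1 : K) + μ.2) ^ 2 * ((μ.1 * μ.2)⁻¹ : Kˣ), μ.1 * μ.2), ⟨?_, hdet'⟩,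
    rfl, rfl⟩
  change algebraMap K 𝔸K _ ∈ I '' C
  rw [← hIg, ← hIc']
  exact ⟨c, hc, rfl⟩

end Main

end Literature.NumberTheory.Automorphic
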